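import Literature.NumberTheory.LFunctions.GranvilleSoundararajanCosPrimeSum
import Literature.NumberTheory.LFunctions.HalaszRestricted
import HarnessLib

/-!
# Halász's theorem for block-restricted sums in short intervals, II: the Euler-product window bounds

Second file of the short-interval restricted Halász theorem (after `HalaszRestrictedShort.lean`).  The chain of
part I bounds `‖S_a(ρx) - S_a(x)‖` (`a = g̃ 1_𝒮`, `ρ = 1 + δ`) by `(δx/log x) ∫_{1/(2 log x)}^1 B(α) dα/α` plus
secondary terms, where `B(α)` is any bound for `‖𝒢_a(1+α+iy)‖` on the window `|y| ≤ T'`.  Here the window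
bound is taken from the EULER PRODUCT `𝒢_a = G_∁ ∏_i (G_i - 1)` at `1 + α` itself rather than from the `1`-line
(as in Granville–Soundararajan / `HalaszRestricted.lean`, where `B = min(e⁷ log x · e^{-M_½}, e^{12}/α)` produces
Halász's factor `(1 + M_½)`), in three regions of `(α, y)`:

* the CORE `|y| ≤ y_c`, `α ≤ α_c` (`y_c = α_c = 1/(2(log Q + 2))`), where the block factors are frozen at their value
  at `y = 0`: `∑_i (K_i(α) + Re z_i)/2 ≤ K_E - Σ_B/2 + 1` (`Σ_B = ∑_{p ∈ E} (1 - Re g(p))/p`), and `G_∁` — the Euler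
  product of the completely multiplicative `g 1_{(n,E)=1}` — is bounded by the tree's two regimes
  (`Halasz.norm_G_shift_le`, Poisson transport of the `1`-line; and the product at `1 + α`);
* the OUTER band `y_c ≤ |y| ≤ T'`, where the repulsion inequality
  `𝔻^{(α)}(g, n^{iy})² + 𝔻^{(α)}(g, 1)² ≥ 2 ∑_p p^{-1-α} (1 - |cos((y/2) log p)|)` and Granville–Soundararajan's
  Lemma 2.3 (`GranvilleSoundararajan.sum_abs_cos_log_prime_div_le`, tree, from the prime number theorem) give
  `‖𝒢_a(1+α+iy)‖ ≤ C α⁻¹ (log x)^{-1/9}`;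
* `α ≥ α_c`: the trivial `e^{12}/α`.

The first section supplies the TAIL form of Granville–Soundararajan's Lemma 2.3 (their proof, tree file
`GranvilleSoundararajanCosPrimeSum.lean`, with the primes `p ≤ Y` kept on the left instead of being estimated by
Mertens): `∑_{Y < p ≤ x} |cos((β/2) log p)|/p ≤ (2/π) log(log x/log Y) + O(1)` for `|β| log Y ≥ 1`,
`log Y ≥ (10/c)² (log log x)²` — needed for the repulsion of the NON-BLOCK primes alone.

## References
* A. Granville, K. Soundararajan, *Decay of mean values of multiplicative functions*, Canad. J. Math. 55 (2003),
  Lemma 2.3 and its proof, §4. [cite: GranvilleSoundararajan2003, Lemma 2.3]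
* K. Matomäki, M. Radziwiłł, T. Tao, Algebra & Number Theory 9 (2015), Appendix A, proof of Proposition A.3.
  [cite: MatomakiRadziwillTao2015, Appendix A]

## Design choices
* No definitions, no named facts; constants explicit but crude.
-/

noncomputable section

open Finset Real Complex MeasureTheory
open scoped ComplexConjugate

namespace Literature.NumberTheory.LFunctions

namespace Halasz

namespace Restricted

open Literature.NumberTheory.LFunctions.Mertens (primeRecipSum)
open Literature.NumberTheory.LFunctions.GranvilleSoundararajan

/-! ### The tail form of Granville–Soundararajan's Lemma 2.3 -/

/-- **Granville–Soundararajan's Lemma 2.3, tail form, with explicit constants.**  Let `c > 0`, `K₁ ≥ 0` be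
constants of the windowed prime number theorem `|∑_{u < p ≤ v} 1/p - (log log v - log log u)| ≤ K₁ exp(-c√log u)`
(`2 ≤ u ≤ v`).  Let `ℓ ≥ 1`, `0 < |β| ≤ ℓ`, and `Λ` with `1 ≤ Λ < ℓ`, `1/|β| ≤ Λ`, `√Λ ≥ (10/c) log ℓ`.  Then
`∑_{e^Λ < p ≤ e^ℓ} |cos((β/2) log p)|/p ≤ (2/π)(log ℓ - log Λ) + 9 + 16 K₁`
(the proof of `GranvilleSoundararajan.cosLogSum_le_of_window` without the Mertens step for `p ≤ e^Λ`).
[cite: GranvilleSoundararajan2003, proof of Lemma 2.3] -/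
theorem cosLogSum_tail_le_of_window {c K₁ : ℝ} (hc : 0 < c) (hK₁ : 0 ≤ K₁)
    (hwin : ∀ u v : ℝ, 2 ≤ u → u ≤ v →
      |primeRecipSum v - primeRecipSum u - (Real.log (Real.log v) - Real.log (Real.log u))| ≤
        K₁ * Real.exp (-(c * Real.sqrt (Real.log u))))
    {β ℓ Λ : ℝ} (hℓ1 : 1 ≤ ℓ) (hβ0 : β ≠ 0) (hβℓ : |β| ≤ ℓ) (hΛ1 : 1 ≤ Λ) (hΛℓ : Λ < ℓ)
    (hβΛ : 1 / |β| ≤ Λ) (hcΛ : 10 / c * Real.log ℓ ≤ Real.sqrt Λ) :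
    (∑ p ∈ Nat.primesLE ⌊Real.exp ℓ⌋₊, |Real.cos (β / 2 * Real.log p)| / p) -
        ∑ p ∈ Nat.primesLE ⌊Real.exp Λ⌋₊, |Real.cos (β / 2 * Real.log p)| / p ≤
      2 / π * (Real.log ℓ - Real.log Λ) + 9 + 16 * K₁ := by
  have hℓ0 : 0 < ℓ := by linarith
  have hΛ0 : 0 < Λ := by linarith
  have hβ : 0 < |β| := abs_pos.mpr hβ0
  -- parameters of the covering
  set N : ℕ := ⌈ℓ⌉₊ ^ 3 with hN
  have hceil : ℓ ≤ ⌈ℓ⌉₊ := Nat.le_ceil ℓ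
  have hceil' : (⌈ℓ⌉₊ : ℝ) ≤ ℓ + 1 := (Nat.ceil_lt_add_one hℓ0.le).le
  have hNℓ : ℓ ^ 3 ≤ N := by
    rw [hN]; push_cast; gcongr
  have hNℓ' : (N : ℝ) ≤ (2 * ℓ) ^ 3 := by
    rw [hN]; push_cast
    calc (⌈ℓ⌉₊ : ℝ) ^ 3 ≤ (ℓ + 1) ^ 3 := by gcongr
      _ ≤ (2 * ℓ) ^ 3 := by gcongr; linarith
  have hNpos : 0 < N := by
    rw [hN]; exact pow_pos (Nat.ceil_pos.mpr hℓ0) 3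
  have hN0 : (0 : ℝ) < N := by exact_mod_cast hNpos
  set h : ℝ := (ℓ - Λ) / N with hh
  have hh0 : 0 ≤ h := div_nonneg (by linarith) hN0.le
  have hhℓ : h ≤ (ℓ ^ 2)⁻¹ := by
    rw [hh, div_le_iff₀ hN0]
    calc ℓ - Λ ≤ ℓ := by linarith
      _ = (ℓ ^ 2)⁻¹ * ℓ ^ 3 := by field_simp
      _ ≤ (ℓ ^ 2)⁻¹ * N := by gcongr
  have hβh : |β| * h ≤ ℓ⁻¹ := by
    calc |β| * h ≤ ℓ * (ℓ ^ 2)⁻¹ := mul_le_mul hβℓ hhℓ hh0 hℓ0.le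
      _ = ℓ⁻¹ := by field_simp
  have hℓinv : ℓ⁻¹ ≤ 1 := inv_le_one_of_one_le₀ hℓ1
  -- the window error `E = K₁ exp(-c√Λ) ≤ K₁ ℓ^{-10}`
  set E : ℝ := K₁ * Real.exp (-(c * Real.sqrt Λ)) with hE
  have hE0 : 0 ≤ E := by positivity
  have hEℓ : E ≤ K₁ * (ℓ ^ 10)⁻¹ :=
    mul_le_mul_of_nonneg_left (exp_neg_mul_sqrt_le_pow hc hℓ0 hcΛ) hK₁
  -- the windowed prime number theorem on each window
  have hwin' : ∀ j : ℕ, j < N →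
      primeRecipSum (Real.exp (Λ + (j + 1 : ℕ) * ((ℓ - Λ) / N))) -
          primeRecipSum (Real.exp (Λ + j * ((ℓ - Λ) / N))) ≤
        Real.log (Λ + (j + 1 : ℕ) * ((ℓ - Λ) / N)) - Real.log (Λ + j * ((ℓ - Λ) / N)) + E := by
    intro j _
    rw [← hh]
    have hju : Λ ≤ Λ + j * h := by nlinarith [hh0, (Nat.cast_nonneg j : (0 : ℝ) ≤ j)]
    have hjv : Λ + j * h ≤ Λ + (j + 1 : ℕ) * h := by push_cast; nlinarith
    have h2u : (2 : ℝ) ≤ Real.exp (Λ + j * h) := by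
      have : (2 : ℝ) ≤ Real.exp 1 := by have := Real.add_one_le_exp (1 : ℝ); linarith
      exact this.trans (Real.exp_le_exp.mpr (by linarith))
    have hw := hwin _ _ h2u (Real.exp_le_exp.mpr hjv)
    rw [Real.log_exp, Real.log_exp, abs_le] at hw
    have hmono : Real.exp (-(c * Real.sqrt (Λ + j * h))) ≤ Real.exp (-(c * Real.sqrt Λ)) := by
      apply Real.exp_le_exp.mpr
      have := Real.sqrt_le_sqrt hju
      nlinarith
    have : K₁ * Real.exp (-(c * Real.sqrt (Λ + j * h))) ≤ E := mul_le_mul_of_nonneg_left hmono hK₁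
    linarith [hw.2]
  -- the primes `Y < p ≤ x`
  have hbig := cosLogSum_sub_le_integral β hΛ0 hΛℓ.le hNpos hE0 hwin'
  rw [← hh] at hbig
  -- the integral
  have hint : ∫ u in Λ..ℓ, |Real.cos (β / 2 * u)| / u ≤ 2 / π * Real.log (ℓ / Λ) + 8 := by
    have heq : ∫ u in Λ..ℓ, |Real.cos (β / 2 * u)| / u = ∫ u in Λ..ℓ, |Real.cos (|β| / 2 * u)| / u := by
      refine intervalIntegral.integral_congr fun u _ => ?_
      show |Real.cos (β / 2 * u)| / u = |Real.cos (|β| / 2 * u)| / u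
      rcases le_or_gt 0 β with hb | hb
      · rw [abs_of_nonneg hb]
      · rw [abs_of_neg hb, show -β / 2 * u = -(β / 2 * u) by ring, Real.cos_neg]
    rw [heq]
    refine integral_abs_cos_mul_div_le (by positivity) hΛ0 hΛℓ.le ?_
    have h1 : 1 ≤ |β| * Λ := by
      calc (1 : ℝ) = |β| * (1 / |β|) := by field_simp
        _ ≤ |β| * Λ := by gcongr
    linarith
  rw [Real.log_div hℓ0.ne' hΛ0.ne', mul_sub] at hint
  -- the small terms
  have ht1 : |β| * h * (Real.log ℓ - Real.log Λ) ≤ 1 := by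
    have hlogℓ : Real.log ℓ ≤ ℓ := (Real.log_le_sub_one_of_pos hℓ0).trans (by linarith)
    have hlogΛ0 : 0 ≤ Real.log Λ := Real.log_nonneg hΛ1
    calc |β| * h * (Real.log ℓ - Real.log Λ) ≤ ℓ⁻¹ * ℓ :=
          mul_le_mul hβh (by linarith) (by linarith [Real.log_le_log hΛ0 hΛℓ.le]) (by positivity)
      _ = 1 := inv_mul_cancel₀ hℓ0.ne'
  have ht2 : (N : ℝ) * (1 + |β| * h / 2) * E ≤ 16 * K₁ := by
    have h1 : 1 + |β| * h / 2 ≤ 2 := by linarith [hβh.trans hℓinv]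
    have hpow : ℓ ^ 3 * (ℓ ^ 10)⁻¹ ≤ 1 := by
      rw [← div_eq_mul_inv, div_le_one (pow_pos hℓ0 10)]
      exact pow_le_pow_right₀ hℓ1 (by norm_num)
    calc (N : ℝ) * (1 + |β| * h / 2) * E ≤ (2 * ℓ) ^ 3 * 2 * (K₁ * (ℓ ^ 10)⁻¹) := by
          gcongr
      _ = 16 * K₁ * (ℓ ^ 3 * (ℓ ^ 10)⁻¹) := by ring
      _ ≤ 16 * K₁ * 1 := mul_le_mul_of_nonneg_left hpow (by positivity)
      _ = 16 * K₁ := mul_one _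
  linarith [hbig, hint, ht1, ht2]

/-- **The tail form of Lemma 2.3, packaged**: there are absolute `c > 0` and `K` such that for `ℓ ≥ 1`,
`0 < |β| ≤ ℓ`, `1 ≤ Λ < ℓ`, `1/|β| ≤ Λ` and `√Λ ≥ (10/c) log ℓ`,
`∑_{e^Λ < p ≤ e^ℓ} |cos((β/2) log p)|/p ≤ (2/π) log(ℓ/Λ) + K`. [cite: GranvilleSoundararajan2003, Lemma 2.3] -/
theorem exists_cosLogSum_tail_le :
    ∃ c : ℝ, 0 < c ∧ ∃ K : ℝ, 0 ≤ K ∧ ∀ (β ℓ Λ : ℝ), 1 ≤ ℓ → β ≠ 0 → |β| ≤ ℓ → 1 ≤ Λ → Λ < ℓ →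
      1 / |β| ≤ Λ → 10 / c * Real.log ℓ ≤ Real.sqrt Λ →
      (∑ p ∈ Nat.primesLE ⌊Real.exp ℓ⌋₊, |Real.cos (β / 2 * Real.log p)| / p) -
          ∑ p ∈ Nat.primesLE ⌊Real.exp Λ⌋₊, |Real.cos (β / 2 * Real.log p)| / p ≤
        2 / π * (Real.log ℓ - Real.log Λ) + K := by
  obtain ⟨c, hc, K₀, hK₀⟩ := Literature.NumberTheory.LFunctions.Mertens.abs_primeRecipSum_window_sub_le_expSqrt
  set K₁ : ℝ := max K₀ 0 with hK₁
  have hK₁0 : 0 ≤ K₁ := le_max_right _ _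
  have hwin : ∀ u v : ℝ, 2 ≤ u → u ≤ v →
      |primeRecipSum v - primeRecipSum u - (Real.log (Real.log v) - Real.log (Real.log u))| ≤
        K₁ * Real.exp (-(c * Real.sqrt (Real.log u))) := fun u v hu huv =>
    (hK₀ u v hu huv).trans (mul_le_mul_of_nonneg_right (le_max_left _ _) (Real.exp_pos _).le)
  refine ⟨c, hc, 9 + 16 * K₁, by positivity, fun β ℓ Λ hℓ1 hβ0 hβℓ hΛ1 hΛℓ hβΛ hcΛ => ?_⟩
  have := cosLogSum_tail_le_of_window hc hK₁0 hwin hℓ1 hβ0 hβℓ hΛ1 hΛℓ hβΛ hcΛ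
  linarith

/-! ### The repulsion inequality -/

/-- `‖e^{iθ} + 1‖ = 2 |cos(θ/2)|`. [folklore] -/
theorem norm_exp_mul_I_add_one (θ : ℝ) : ‖Complex.exp ((θ : ℂ) * I) + 1‖ = 2 * |Real.cos (θ / 2)| := by
  have h1 : Complex.exp ((θ : ℂ) * I) + 1 = ((Real.cos θ + 1 : ℝ) : ℂ) + ((Real.sin θ : ℝ) : ℂ) * I := by
    rw [Complex.exp_mul_I, ← Complex.ofReal_cos, ← Complex.ofReal_sin]
    push_cast; ring
  rw [h1, Complex.norm_add_mul_I]
  have h2 : (Real.cos θ + 1) ^ 2 + Real.sin θ ^ 2 = (2 * Real.cos (θ / 2)) ^ 2 := by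
    have hc : Real.cos θ = 2 * Real.cos (θ / 2) ^ 2 - 1 := by
      have h := Real.cos_sq (θ / 2)
      rw [show 2 * (θ / 2) = θ by ring] at h
      linarith
    nlinarith [Real.sin_sq_add_cos_sq θ, Real.sin_sq_add_cos_sq (θ / 2)]
  rw [h2, Real.sqrt_sq_eq_abs, abs_mul, abs_two]

/-- **Termwise repulsion**: for `‖u‖ ≤ 1`, a natural number `p > 0` and real `t`,
`Re(u · conj(p^{it})) + Re u ≤ 2 |cos((t/2) log p)|`
(`Re(u (p^{-it} + 1)) ≤ ‖p^{-it} + 1‖ = 2|cos((t log p)/2)|`). [cite: GranvilleSoundararajan2003, §4 (proof of Theorem 1)] -/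
theorem re_mul_conj_cpow_add_re_le {u : ℂ} (hu : ‖u‖ ≤ 1) {p : ℕ} (hp : 0 < p) (t : ℝ) :
    (u * conj ((p : ℂ) ^ ((t : ℂ) * I))).re + u.re ≤ 2 * |Real.cos (t / 2 * Real.log p)| := by
  have hpC : (p : ℂ) ≠ 0 := by exact_mod_cast hp.ne'
  have hw : conj ((p : ℂ) ^ ((t : ℂ) * I)) = Complex.exp (((-(t * Real.log p) : ℝ) : ℂ) * I) := by
    rw [conj_natCast_cpow_mul_I p, Complex.cpow_def_of_ne_zero hpC, ← Complex.ofReal_natCast,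
      ← Complex.ofReal_log (Nat.cast_nonneg p)]
    congr 1
    push_cast; ring
  have hsum : (u * conj ((p : ℂ) ^ ((t : ℂ) * I))).re + u.re = (u * (conj ((p : ℂ) ^ ((t : ℂ) * I)) + 1)).re := by
    rw [mul_add, mul_one, Complex.add_re]
  rw [hsum]
  refine (Complex.re_le_norm _).trans ?_
  rw [norm_mul, hw, norm_exp_mul_I_add_one]
  have hcos : Real.cos (-(t * Real.log p) / 2) = Real.cos (t / 2 * Real.log p) := by
    rw [show -(t * Real.log p) / 2 = -(t / 2 * Real.log p) by ring, Real.cos_neg]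
  rw [hcos]
  calc ‖u‖ * (2 * |Real.cos (t / 2 * Real.log p)|) ≤ 1 * (2 * |Real.cos (t / 2 * Real.log p)|) :=
        mul_le_mul_of_nonneg_right hu (by positivity)
    _ = _ := one_mul _

/-- **Termwise repulsion for the distance summands**: for `‖u‖ ≤ 1`, `p > 0`, real `t`,
`(1 - Re(u conj(p^{it}))) + (1 - Re u) ≥ 2 (1 - |cos((t/2) log p)|)`. [cite: GranvilleSoundararajan2003, §4] -/
theorem one_sub_re_add_one_sub_re_ge {u : ℂ} (hu : ‖u‖ ≤ 1) {p : ℕ} (hp : 0 < p) (t : ℝ) :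
    2 * (1 - |Real.cos (t / 2 * Real.log p)|) ≤
      (1 - (u * conj ((p : ℂ) ^ ((t : ℂ) * I))).re) + (1 - u.re) := by
  have := re_mul_conj_cpow_add_re_le hu hp t
  linarith

/-- **Summed repulsion with damping weights**: for `|g| ≤ 1`, nonnegative weights `w p`, a set `P` of positive
integers and real `t`,
`2 ∑_{p ∈ P} w_p (1 - |cos((t/2) log p)|) ≤ ∑_{p ∈ P} w_p (1 - Re(g(p) conj(p^{it}))) + ∑_{p ∈ P} w_p (1 - Re g(p))`.
[cite: GranvilleSoundararajan2003, §4] -/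
theorem two_mul_sum_repulsion_le {g : ℕ → ℂ} (hgb : ∀ n, ‖g n‖ ≤ 1) {P : Finset ℕ} (hP : ∀ p ∈ P, 0 < p)
    {w : ℕ → ℝ} (hw : ∀ p ∈ P, 0 ≤ w p) (t : ℝ) :
    2 * ∑ p ∈ P, w p * (1 - |Real.cos (t / 2 * Real.log p)|) ≤
      ∑ p ∈ P, w p * (1 - (g p * conj ((p : ℂ) ^ ((t : ℂ) * I))).re) + ∑ p ∈ P, w p * (1 - (g p).re) := by
  rw [Finset.mul_sum, ← Finset.sum_add_distrib]
  refine Finset.sum_le_sum fun p hp => ?_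
  have h := one_sub_re_add_one_sub_re_ge (hgb p) (hP p hp) t
  have hw0 := hw p hp
  nlinarith

/-! ### The exponent on the line `Re s = 1 + α`: damped distances -/

variable {ι : Type*} {𝓙 : Finset ι} {blk : ι → Finset ℕ} {g : ℕ → ℂ} {N : ℕ}

/-- `Re(c p^{-(1+α+iy)}) = p^{-(1+α)} Re(c conj(p^{iy}))` for `p > 0`. [folklore] -/
theorem re_mul_cpow_neg_add (c : ℂ) {p : ℕ} (hp : 0 < p) (α y : ℝ) :
    (c * (p : ℂ) ^ (-((1 : ℂ) + α + y * I))).re =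
      (p : ℝ) ^ (-(1 + α)) * (c * conj ((p : ℂ) ^ ((y : ℂ) * I))).re := by
  have hp0 : (p : ℂ) ≠ 0 := by exact_mod_cast hp.ne'
  have hsplit : -((1 : ℂ) + α + y * I) = (((-(1 + α) : ℝ)) : ℂ) + (-((y : ℂ) * I)) := by push_cast; ring
  rw [hsplit, Complex.cpow_add _ _ hp0, ← conj_natCast_cpow_mul_I p y]
  have hreal : (p : ℂ) ^ (((-(1 + α) : ℝ)) : ℂ) = (((p : ℝ) ^ (-(1 + α)) : ℝ) : ℂ) := by
    rw [← Complex.ofReal_natCast, ← Complex.ofReal_cpow (Nat.cast_nonneg p)]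
  rw [hreal]
  calc (c * ((((p : ℝ) ^ (-(1 + α)) : ℝ) : ℂ) * conj ((p : ℂ) ^ ((y : ℂ) * I)))).re
      = ((((p : ℝ) ^ (-(1 + α)) : ℝ) : ℂ) * (c * conj ((p : ℂ) ^ ((y : ℂ) * I)))).re := by ring_nf
    _ = (p : ℝ) ^ (-(1 + α)) * (c * conj ((p : ℂ) ^ ((y : ℂ) * I))).re := Complex.re_ofReal_mul _ _

/-- The distance summand is nonnegative: `0 ≤ 1 - Re(g(p) conj(p^{iy}))` for `|g| ≤ 1`. [folklore] -/
theorem one_sub_re_nonneg (hgb : ∀ n, ‖g n‖ ≤ 1) (p : ℕ) (y : ℝ) :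
    0 ≤ 1 - (g p * conj ((p : ℂ) ^ ((y : ℂ) * I))).re := by
  have h1 : (g p * conj ((p : ℂ) ^ ((y : ℂ) * I))).re ≤ ‖g p * conj ((p : ℂ) ^ ((y : ℂ) * I))‖ :=
    Complex.re_le_norm _
  have h2 : ‖g p * conj ((p : ℂ) ^ ((y : ℂ) * I))‖ ≤ 1 := by
    rw [norm_mul, Complex.norm_conj]
    rcases Nat.eq_zero_or_pos p with rfl | hp
    · rcases eq_or_ne ((y : ℂ) * I) 0 with h0 | h0
      · simp [h0]; exact hgb 0
      · simp [Complex.zero_cpow h0]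
    · rw [Complex.norm_natCast_cpow_of_pos hp]
      simp only [Complex.mul_re, Complex.ofReal_re, Complex.I_re, mul_zero, Complex.ofReal_im,
        Complex.I_im, mul_one, sub_self, Real.rpow_zero, mul_one]
      exact hgb p
  linarith

/-- **The exponent of the restricted series on `Re s = 1 + α` is at most `∑ p^{-1-α}` minus HALF the damped
distance**: for a block system at level `N`, `|g| ≤ 1`, `α, y` real, with `Pr` the primes `≤ N` and
`s = 1 + α + iy`,
`∑_{p ∉ E} Re(g(p)p^{-s}) + ∑_i (K_i(α) + Re z_i)/2 ≤ ∑_{p ∈ Pr} p^{-1-α} - ½ ∑_{p ∈ Pr} p^{-1-α}(1 - Re(g(p) conj(p^{iy})))`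
(off `E` the full deficiency is available and we keep half of it; on `E` this is an identity). [folklore] -/
theorem exponent_le_sub_half_damped [DecidableEq ι] (h : IsBlockSystem 𝓙 blk N) (hgb : ∀ n, ‖g n‖ ≤ 1)
    (α y : ℝ) :
    ∑ p ∈ Nat.primesBelow (N + 1) \ 𝓙.biUnion blk, (g p * (p : ℂ) ^ (-((1 : ℂ) + α + y * I))).re +
        ∑ i ∈ 𝓙, (∑ p ∈ blk i, (p : ℝ) ^ (-((1 : ℂ) + α + y * I).re) +
          (∑ p ∈ blk i, g p * (p : ℂ) ^ (-((1 : ℂ) + α + y * I))).re) / 2 ≤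
      ∑ p ∈ Nat.primesBelow (N + 1), (p : ℝ) ^ (-(1 + α)) -
        (1 / 2) * ∑ p ∈ Nat.primesBelow (N + 1),
          (p : ℝ) ^ (-(1 + α)) * (1 - (g p * conj ((p : ℂ) ^ ((y : ℂ) * I))).re) := by
  set E := 𝓙.biUnion blk with hE
  set Pr := Nat.primesBelow (N + 1) with hPr
  have hEsub : E ⊆ Pr := h.biUnion_subset (t := 𝓙) le_rfl
  have hres : ((1 : ℂ) + α + y * I).re = 1 + α := by simp
  set d : ℕ → ℝ := fun p => 1 - (g p * conj ((p : ℂ) ^ ((y : ℂ) * I))).re with hd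
  set w : ℕ → ℝ := fun p => (p : ℝ) ^ (-(1 + α)) with hw
  have hd0 : ∀ p, 0 ≤ d p := fun p => one_sub_re_nonneg hgb p y
  have hw0 : ∀ p, 0 ≤ w p := fun p => by simp only [hw]; positivity
  have hre : ∀ p : ℕ, 0 < p → (g p * (p : ℂ) ^ (-((1 : ℂ) + α + y * I))).re = w p - w p * d p := by
    intro p hp
    rw [re_mul_cpow_neg_add (g p) hp α y]
    simp only [hw, hd]; ring
  -- right-hand side split over `Pr minus E` and `E`
  have hR : ∑ p ∈ Pr, w p - 1 / 2 * ∑ p ∈ Pr, w p * d p =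
      ∑ p ∈ Pr \ E, (w p - 1 / 2 * (w p * d p)) + ∑ p ∈ E, (w p - 1 / 2 * (w p * d p)) := by
    rw [Finset.mul_sum, ← Finset.sum_sub_distrib, ← Finset.sum_sdiff hEsub]
  have hw' : ∑ p ∈ Nat.primesBelow (N + 1), (p : ℝ) ^ (-(1 + α)) = ∑ p ∈ Pr, w p := rfl
  have hwd' : ∑ p ∈ Nat.primesBelow (N + 1), (p : ℝ) ^ (-(1 + α)) * (1 - (g p * conj ((p : ℂ) ^ ((y : ℂ) * I))).re) =
      ∑ p ∈ Pr, w p * d p := rfl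
  rw [hw', hwd', hR]
  refine add_le_add ?_ ?_
  · refine Finset.sum_le_sum fun p hp => ?_
    rw [Finset.mem_sdiff, hPr, Nat.mem_primesBelow] at hp
    rw [hre p hp.1.2.pos]
    have := mul_nonneg (hw0 p) (hd0 p)
    linarith
  · rw [hE, Finset.sum_biUnion (fun i hi j hj hij => h.disjoint i hi j hj hij)]
    refine Finset.sum_le_sum fun i hi => le_of_eq ?_
    rw [hres, Complex.re_sum, ← Finset.sum_add_distrib, Finset.sum_div]
    refine Finset.sum_congr rfl fun p hp => ?_
    have hpp := h.prime_of_mem hi hp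
    rw [hre p hpp.pos]
    simp only [hw]
    ring

/-- **The damped distance dominates damped repulsion minus the distance from `1`**: for `|g| ≤ 1` and
a set `Pr` of positive integers,
`∑_{Pr} p^{-1-α}(1 - Re(g(p)conj(p^{iy}))) ≥ 2 ∑_{Pr} p^{-1-α}(1 - |cos((y/2) log p)|) - ∑_{Pr} p^{-1-α}(1 - Re g(p))`.
[cite: GranvilleSoundararajan2003, §4] -/
theorem damped_dist_ge_repulsion_sub (hgb : ∀ n, ‖g n‖ ≤ 1) {Pr : Finset ℕ} (hPr : ∀ p ∈ Pr, 0 < p)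
    (α y : ℝ) :
    2 * ∑ p ∈ Pr, (p : ℝ) ^ (-(1 + α)) * (1 - |Real.cos (y / 2 * Real.log p)|) -
        ∑ p ∈ Pr, (p : ℝ) ^ (-(1 + α)) * (1 - (g p).re) ≤
      ∑ p ∈ Pr, (p : ℝ) ^ (-(1 + α)) * (1 - (g p * conj ((p : ℂ) ^ ((y : ℂ) * I))).re) := by
  have := two_mul_sum_repulsion_le hgb hPr (w := fun p => (p : ℝ) ^ (-(1 + α))) (fun p _ => by positivity) y
  linarith

/-- **Damped sums of nonnegative terms dominate undamped sums up to `Z = e^{c₀/α}`**: if `0 ≤ f`, `0 < α`,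
`1 ≤ Z`, `α log Z ≤ c₀` and the primes `≤ Z` are in `Pr`, then
`e^{-c₀} ∑_{p ≤ Z} f(p)/p ≤ ∑_{p ∈ Pr} p^{-1-α} f(p)`. [folklore] -/
theorem exp_neg_mul_sum_div_le_damped {f : ℕ → ℝ} (hf : ∀ p, 0 ≤ f p) {α c₀ Z : ℝ} (hα : 0 < α) (hZ : 1 ≤ Z)
    (hc₀ : α * Real.log Z ≤ c₀) {Pr : Finset ℕ} (hPr : Nat.primesLE ⌊Z⌋₊ ⊆ Pr) (hPr0 : ∀ p ∈ Pr, 0 < p) :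
    Real.exp (-c₀) * ∑ p ∈ Nat.primesLE ⌊Z⌋₊, f p / p ≤ ∑ p ∈ Pr, (p : ℝ) ^ (-(1 + α)) * f p := by
  calc Real.exp (-c₀) * ∑ p ∈ Nat.primesLE ⌊Z⌋₊, f p / p
      = ∑ p ∈ Nat.primesLE ⌊Z⌋₊, Real.exp (-c₀) * (f p / p) := Finset.mul_sum _ _ _
    _ ≤ ∑ p ∈ Nat.primesLE ⌊Z⌋₊, (p : ℝ) ^ (-(1 + α)) * f p := by
        refine Finset.sum_le_sum fun p hp => ?_
        rw [Nat.mem_primesLE] at hp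
        have hp0 : (0 : ℝ) < p := by exact_mod_cast hp.2.pos
        have hpZ : (p : ℝ) ≤ Z := (Nat.cast_le.2 hp.1).trans (Nat.floor_le (by linarith))
        -- `p^{-α} ≥ Z^{-α} ≥ e^{-c₀}`
        have h1 : Real.exp (-c₀) ≤ (p : ℝ) ^ (-α) := by
          rw [Real.rpow_def_of_pos hp0]
          apply Real.exp_le_exp.2
          have hlogp : Real.log p ≤ Real.log Z := Real.log_le_log hp0 hpZ
          have hlogp0 : 0 ≤ Real.log p := Real.log_nonneg (by exact_mod_cast hp.2.one_lt.le)
          nlinarith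
        have h2 : (p : ℝ) ^ (-(1 + α)) = (p : ℝ) ^ (-α) * (1 / p) := by
          rw [show -(1 + α) = -α + (-1) by ring, Real.rpow_add hp0, Real.rpow_neg_one, one_div]
        rw [h2]
        calc Real.exp (-c₀) * (f p / p) = Real.exp (-c₀) * f p * (1 / p) := by ring
          _ ≤ (p : ℝ) ^ (-α) * f p * (1 / p) := by
              gcongr
              exact hf p
          _ = (p : ℝ) ^ (-α) * (1 / p) * f p := by ring
    _ ≤ ∑ p ∈ Pr, (p : ℝ) ^ (-(1 + α)) * f p :=
        Finset.sum_le_sum_of_subset_of_nonneg hPr fun p hp _ => mul_nonneg (by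
          have := hPr0 p hp; positivity) (hf p)

/-- Damping only decreases sums of nonnegative terms: `∑_{Pr} p^{-1-α} f(p) ≤ ∑_{Pr} f(p)/p` (`α ≥ 0`). [folklore] -/
theorem sum_damped_le_sum_div {f : ℕ → ℝ} (hf : ∀ p, 0 ≤ f p) {α : ℝ} (hα : 0 ≤ α) {Pr : Finset ℕ}
    (hPr : ∀ p ∈ Pr, 0 < p) :
    ∑ p ∈ Pr, (p : ℝ) ^ (-(1 + α)) * f p ≤ ∑ p ∈ Pr, f p / p := by
  refine Finset.sum_le_sum fun p hp => ?_
  have hp1 : (1 : ℝ) ≤ p := by exact_mod_cast hPr p hp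
  have h1 : (p : ℝ) ^ (-(1 + α)) ≤ (p : ℝ) ^ (-1 : ℝ) := Real.rpow_le_rpow_of_exponent_le hp1 (by linarith)
  rw [Real.rpow_neg_one] at h1
  calc (p : ℝ) ^ (-(1 + α)) * f p ≤ (p : ℝ)⁻¹ * f p := mul_le_mul_of_nonneg_right h1 (hf p)
    _ = f p / p := by rw [div_eq_inv_mul]

/-- Mertens, lower half, crude: `∑_{p ≤ Z} 1/p ≥ log log Z - 9` for `Z ≥ 2`. [folklore] -/
theorem loglog_sub_nine_le_sum_primesLE_inv {Z : ℝ} (hZ : 2 ≤ Z) :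
    Real.log (Real.log Z) - 9 ≤ ∑ p ∈ Nat.primesLE ⌊Z⌋₊, (1 : ℝ) / p := by
  have h := Literature.NumberTheory.LFunctions.MertensBound.loglog_sub_loglog_le_sum_inv_prime (P := 2) le_rfl hZ
  have hsub : (Finset.Ioc ⌊(2:ℝ)⌋₊ ⌊Z⌋₊).filter Nat.Prime ⊆ Nat.primesLE ⌊Z⌋₊ := by
    intro p hp
    rw [Finset.mem_filter, Finset.mem_Ioc] at hp
    exact Nat.mem_primesLE.2 ⟨hp.1.2, hp.2⟩
  have hle : ∑ p ∈ (Finset.Ioc ⌊(2:ℝ)⌋₊ ⌊Z⌋₊).filter Nat.Prime, (1 : ℝ) / p ≤ ∑ p ∈ Nat.primesLE ⌊Z⌋₊, (1 : ℝ) / p :=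
    Finset.sum_le_sum_of_subset_of_nonneg hsub fun p _ _ => by positivity
  have hlog2 : (0.6931471803 : ℝ) < Real.log 2 := Real.log_two_gt_d9
  have hlog2' : Real.log 2 < 0.6931471808 := Real.log_two_lt_d9
  have hll2 : Real.log (Real.log 2) ≤ 0 := Real.log_nonpos (by linarith) (by linarith)
  have h6 : 6 / Real.log 2 ≤ 9 := by rw [div_le_iff₀ (by linarith)]; linarith
  linarith

/-- **The OUTER window bound from the Euler product** (the band `1/log Z ≤ |y| ≤ log Z`).  Let `a = g̃ 1_𝒮` for a
block system at level `⌊x⌋`, `g` completely multiplicative with `|g| ≤ 1`, `0 < α ≤ 1`, and let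
`3 ≤ Z ≤ x` with `α log Z ≤ c₀`.  Let `K` be a constant of Granville–Soundararajan's Lemma 2.3
(`GranvilleSoundararajan.sum_abs_cos_log_prime_div_le`).  Then for `1/log Z ≤ |y| ≤ log Z`, with
`M₁ = ∑_{p ≤ x} (1 - Re g(p))/p` (the distance of `g` from `1`),
`‖𝒢_a(1+α+iy)‖ ≤ e^{12} α⁻¹ e^{M₁/2} exp(-e^{-c₀}((1 - 2/π)(log log Z - log max(1/|y|, (log log Z)²)) - K - 9))`:
the repulsion `2 ∑_p p^{-1-α}(1 - |cos((y/2)log p)|)` between the twists `0` and `y`, localised to `p ≤ Z = e^{c₀/α}` where the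
damping is harmless, minus the distance from `1`.  [cite: GranvilleSoundararajan2003, Lemma 2.3 and §4] -/
theorem norm_LSeries_restr_outer_le [DecidableEq ι] {x : ℝ} (h : IsBlockSystem 𝓙 blk ⌊x⌋₊)
    (hg : ∀ m n, g (m * n) = g m * g n) (hg1 : g 1 = 1) (hgb : ∀ n, ‖g n‖ ≤ 1)
    {α : ℝ} (hα : 0 < α) (hα1 : α ≤ 1) {Z c₀ : ℝ} (hZ3 : 3 ≤ Z) (hZx : Z ≤ x)
    (hαZ : α * Real.log Z ≤ c₀) {K : ℝ}
    (hGS : ∀ x' : ℝ, 3 ≤ x' → ∀ β : ℝ, 1 / Real.log x' ≤ |β| → |β| ≤ Real.log x' →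
      ∑ p ∈ Nat.primesLE ⌊x'⌋₊, |Real.cos (β / 2 * Real.log p)| / p ≤
        2 / π * Real.log (Real.log x') + (1 - 2 / π) * Real.log (max (1 / |β|) (Real.log (Real.log x') ^ 2)) + K)
    {y : ℝ} (hy1 : 1 / Real.log Z ≤ |y|) (hy2 : |y| ≤ Real.log Z) :
    ‖LSeries (restr 𝓙 blk g ⌊x⌋₊) (1 + α + y * I)‖ ≤
      Real.exp 12 * (1 / α) * Real.exp ((∑ p ∈ Nat.primesLE ⌊x⌋₊, (1 - (g p).re) / p) / 2) *
        Real.exp (-(Real.exp (-c₀) * ((1 - 2 / π) * (Real.log (Real.log Z) -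
          Real.log (max (1 / |y|) (Real.log (Real.log Z) ^ 2))) - K - 9))) := by
  set Pr := Nat.primesBelow (⌊x⌋₊ + 1) with hPr
  have hPrLE : Pr = Nat.primesLE ⌊x⌋₊ := rfl
  have hPr0 : ∀ p ∈ Pr, 0 < p := fun p hp => (Nat.mem_primesBelow.1 hp).2.pos
  have hres : ((1 : ℂ) + α + y * I).re = 1 + α := by simp
  have hs : (1 : ℝ) ≤ ((1 : ℂ) + α + y * I).re := by rw [hres]; linarith
  -- the Euler-product bound and the exponent
  have h1 := norm_LSeries_restr_le h hg hg1 hgb hs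
  have h2 := exponent_le_sub_half_damped h hgb α y
  -- `∑ p^{-1-α} ≤ log(1/α) + 9`
  have hS := sum_primesLE_rpow_le hα hα1 ⌊x⌋₊
  rw [← hPrLE] at hS
  -- the damped distance: repulsion minus the distance from `1`
  have h3 := damped_dist_ge_repulsion_sub hgb hPr0 α y
  have hM₁ : ∑ p ∈ Pr, (p : ℝ) ^ (-(1 + α)) * (1 - (g p).re) ≤ ∑ p ∈ Nat.primesLE ⌊x⌋₊, (1 - (g p).re) / p := by
    rw [← hPrLE]
    refine sum_damped_le_sum_div (fun p => ?_) hα.le hPr0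
    have := hgb p
    have h' : (g p).re ≤ ‖g p‖ := Complex.re_le_norm _
    linarith
  -- localise the repulsion to `p ≤ Z`
  have hZ1 : 1 ≤ Z := by linarith
  have hZsub : Nat.primesLE ⌊Z⌋₊ ⊆ Pr := by
    intro p hp
    rw [Nat.mem_primesLE] at hp
    rw [hPr, Nat.mem_primesBelow]
    exact ⟨Nat.lt_succ_of_le (hp.1.trans (Nat.floor_le_floor hZx)), hp.2⟩
  have h4 := exp_neg_mul_sum_div_le_damped (f := fun p : ℕ => 1 - |Real.cos (y / 2 * Real.log p)|)
    (fun p => by have := Real.abs_cos_le_one (y / 2 * Real.log p); linarith) hα hZ1 hαZ hZsub hPr0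
  -- the undamped repulsion on `p ≤ Z`: Mertens minus Granville–Soundararajan
  have hGSZ := hGS Z hZ3 y hy1 hy2
  have hMZ := loglog_sub_nine_le_sum_primesLE_inv (Z := Z) (by linarith)
  have hsplit : ∑ p ∈ Nat.primesLE ⌊Z⌋₊, (1 - |Real.cos (y / 2 * Real.log p)|) / p =
      ∑ p ∈ Nat.primesLE ⌊Z⌋₊, (1 : ℝ) / p - ∑ p ∈ Nat.primesLE ⌊Z⌋₊, |Real.cos (y / 2 * Real.log p)| / p := by
    rw [← Finset.sum_sub_distrib]
    exact Finset.sum_congr rfl fun p _ => by ring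
  set Rep : ℝ := (1 - 2 / π) * (Real.log (Real.log Z) - Real.log (max (1 / |y|) (Real.log (Real.log Z) ^ 2))) - K - 9
    with hRep
  have hRep_le : Rep ≤ ∑ p ∈ Nat.primesLE ⌊Z⌋₊, (1 - |Real.cos (y / 2 * Real.log p)|) / p := by
    rw [hsplit, hRep]
    linarith
  -- assemble the exponent
  have hexp_le : 3 + ∑ p ∈ Pr \ 𝓙.biUnion blk, (g p * (p : ℂ) ^ (-((1 : ℂ) + α + y * I))).re +
      ∑ i ∈ 𝓙, (∑ p ∈ blk i, (p : ℝ) ^ (-((1 : ℂ) + α + y * I).re) +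
        (∑ p ∈ blk i, g p * (p : ℂ) ^ (-((1 : ℂ) + α + y * I))).re) / 2 ≤
      12 + Real.log (1 / α) + (∑ p ∈ Nat.primesLE ⌊x⌋₊, (1 - (g p).re) / p) / 2 - Real.exp (-c₀) * Rep := by
    have he0 : 0 < Real.exp (-c₀) := Real.exp_pos _
    have h5 : Real.exp (-c₀) * Rep ≤ ∑ p ∈ Pr, (p : ℝ) ^ (-(1 + α)) * (1 - |Real.cos (y / 2 * Real.log p)|) := by
      refine le_trans (mul_le_mul_of_nonneg_left hRep_le he0.le) ?_
      simpa using h4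
    linarith [h2, h3, hM₁, hS, h5]
  refine h1.trans ?_
  calc Real.exp (3 + ∑ p ∈ Pr \ 𝓙.biUnion blk, (g p * (p : ℂ) ^ (-((1 : ℂ) + α + y * I))).re +
        ∑ i ∈ 𝓙, (∑ p ∈ blk i, (p : ℝ) ^ (-((1 : ℂ) + α + y * I).re) +
          (∑ p ∈ blk i, g p * (p : ℂ) ^ (-((1 : ℂ) + α + y * I))).re) / 2)
      ≤ Real.exp (12 + Real.log (1 / α) + (∑ p ∈ Nat.primesLE ⌊x⌋₊, (1 - (g p).re) / p) / 2 - Real.exp (-c₀) * Rep) :=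
        Real.exp_le_exp.2 hexp_le
    _ = _ := by
        rw [show 12 + Real.log (1 / α) + (∑ p ∈ Nat.primesLE ⌊x⌋₊, (1 - (g p).re) / p) / 2 - Real.exp (-c₀) * Rep =
          12 + Real.log (1 / α) + (∑ p ∈ Nat.primesLE ⌊x⌋₊, (1 - (g p).re) / p) / 2 + -(Real.exp (-c₀) * Rep) by ring,
          Real.exp_add, Real.exp_add, Real.exp_add, Real.exp_log (by positivity)]

/-! ### The CORE: block factors frozen near `y = 0` -/

/-- `‖conj(p^{iy}) - 1‖ ≤ |y| log p` for a natural number `p > 0`. [folklore] -/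
theorem norm_conj_cpow_sub_one_le {p : ℕ} (hp : 0 < p) (y : ℝ) :
    ‖conj ((p : ℂ) ^ ((y : ℂ) * I)) - 1‖ ≤ |y| * Real.log p := by
  have hpC : (p : ℂ) ≠ 0 := by exact_mod_cast hp.ne'
  have hw : conj ((p : ℂ) ^ ((y : ℂ) * I)) = Complex.exp (Complex.I * ((-(y * Real.log p) : ℝ) : ℂ)) := by
    rw [conj_natCast_cpow_mul_I p, Complex.cpow_def_of_ne_zero hpC, ← Complex.ofReal_natCast,
      ← Complex.ofReal_log (Nat.cast_nonneg p)]
    congr 1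
    push_cast; ring
  rw [hw]
  refine (Real.norm_exp_I_mul_ofReal_sub_one_le).trans (le_of_eq ?_)
  rw [Real.norm_eq_abs, abs_neg, abs_mul, abs_of_nonneg (Real.log_nonneg (by exact_mod_cast hp))]

/-- **Freezing one block term**: for `|g| ≤ 1`, `p > 0`, `α ≥ 0`:
`p^{-1-α} + p^{-1-α} Re(g(p) conj(p^{iy})) ≤ (1 + Re g(p))/p + |y| log p / p`
(the damping only helps since `1 + Re(…) ≥ 0`, and `|Re(g(conj p^{iy} - 1))| ≤ |y| log p`). [folklore] -/
theorem block_term_frozen_le (hgb : ∀ n, ‖g n‖ ≤ 1) {p : ℕ} (hp : 0 < p) {α : ℝ} (hα : 0 ≤ α) (y : ℝ) :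
    (p : ℝ) ^ (-(1 + α)) + (p : ℝ) ^ (-(1 + α)) * (g p * conj ((p : ℂ) ^ ((y : ℂ) * I))).re ≤
      (1 + (g p).re) / p + |y| * Real.log p / p := by
  have hp0 : (0 : ℝ) < p := by exact_mod_cast hp
  have hp1 : (1 : ℝ) ≤ p := by exact_mod_cast hp
  set w := conj ((p : ℂ) ^ ((y : ℂ) * I)) with hwdef
  have hnn : 0 ≤ 1 + (g p * w).re := by
    have := one_sub_re_nonneg hgb p y
    have h1 : (-(g p * w)).re ≤ ‖-(g p * w)‖ := Complex.re_le_norm _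
    rw [norm_neg, Complex.neg_re] at h1
    have h2 : ‖g p * w‖ ≤ 1 := by
      have h' : (g p * w).re ≤ ‖g p * w‖ := Complex.re_le_norm _
      -- `‖g p w‖ ≤ 1` as in `one_sub_re_nonneg`
      rw [norm_mul, hwdef, Complex.norm_conj, Complex.norm_natCast_cpow_of_pos hp]
      simp only [Complex.mul_re, Complex.ofReal_re, Complex.I_re, mul_zero, Complex.ofReal_im,
        Complex.I_im, mul_one, sub_self, Real.rpow_zero, mul_one]
      exact hgb p
    linarith
  have hdamp : (p : ℝ) ^ (-(1 + α)) ≤ 1 / p := by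
    have h1 : (p : ℝ) ^ (-(1 + α)) ≤ (p : ℝ) ^ (-1 : ℝ) := Real.rpow_le_rpow_of_exponent_le hp1 (by linarith)
    rwa [Real.rpow_neg_one, ← one_div] at h1
  have hdiff : (g p * w).re - (g p).re ≤ |y| * Real.log p := by
    have h1 : (g p * w).re - (g p).re = (g p * (w - 1)).re := by
      rw [mul_sub, mul_one, Complex.sub_re]
    rw [h1]
    refine (Complex.re_le_norm _).trans ?_
    rw [norm_mul]
    calc ‖g p‖ * ‖w - 1‖ ≤ 1 * (|y| * Real.log p) :=
          mul_le_mul (hgb p) (norm_conj_cpow_sub_one_le hp y) (norm_nonneg _) zero_le_one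
      _ = |y| * Real.log p := one_mul _
  calc (p : ℝ) ^ (-(1 + α)) + (p : ℝ) ^ (-(1 + α)) * (g p * w).re
      = (p : ℝ) ^ (-(1 + α)) * (1 + (g p * w).re) := by ring
    _ ≤ 1 / p * (1 + (g p * w).re) := mul_le_mul_of_nonneg_right hdamp hnn
    _ ≤ 1 / p * (1 + (g p).re + |y| * Real.log p) := by
        refine mul_le_mul_of_nonneg_left ?_ (by positivity)
        linarith
    _ = (1 + (g p).re) / p + |y| * Real.log p / p := by
        field_simp

/-- **The frozen block exponent**: for a block system at level `N` whose block primes are `≤ Q`, `|g| ≤ 1`, `α ≥ 0`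
and real `y`, with `E = ⋃ blk i` and `s = 1 + α + iy`,
`∑_i (K_i(α) + Re z_i)/2 ≤ ∑_{p ∈ E} (1 + Re g(p))/(2p) + (|y|/2) ∑_{p ∈ E} log p/p`,
i.e. `≤ K_E - Σ_B/2 + (|y|/2) Λ_E` (`K_E = ∑_E 1/p`, `Σ_B = ∑_E (1 - Re g(p))/p`, `Λ_E = ∑_E log p/p ≤ log Q + 2`).
[cite: MatomakiRadziwillTao2015, Appendix A, proof of Proposition A.3] -/
theorem block_exponent_frozen_le [DecidableEq ι] (h : IsBlockSystem 𝓙 blk N) (hgb : ∀ n, ‖g n‖ ≤ 1)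
    {α : ℝ} (hα : 0 ≤ α) (y : ℝ) :
    ∑ i ∈ 𝓙, (∑ p ∈ blk i, (p : ℝ) ^ (-((1 : ℂ) + α + y * I).re) +
        (∑ p ∈ blk i, g p * (p : ℂ) ^ (-((1 : ℂ) + α + y * I))).re) / 2 ≤
      (∑ p ∈ 𝓙.biUnion blk, (1 + (g p).re) / p) / 2 + |y| / 2 * ∑ p ∈ 𝓙.biUnion blk, Real.log p / p := by
  have hres : ((1 : ℂ) + α + y * I).re = 1 + α := by simp
  rw [Finset.sum_biUnion (fun i hi j hj hij => h.disjoint i hi j hj hij),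
    Finset.sum_biUnion (fun i hi j hj hij => h.disjoint i hi j hj hij), Finset.sum_div, Finset.mul_sum,
    ← Finset.sum_add_distrib]
  refine Finset.sum_le_sum fun i hi => ?_
  rw [hres, Complex.re_sum, ← Finset.sum_add_distrib, Finset.sum_div, Finset.sum_div, Finset.mul_sum,
    ← Finset.sum_add_distrib]
  refine Finset.sum_le_sum fun p hp => ?_
  have hpp := h.prime_of_mem hi hp
  have ht := block_term_frozen_le hgb hpp.pos hα y
  rw [re_mul_cpow_neg_add (g p) hpp.pos α y]
  have : |y| / 2 * (Real.log p / p) = (|y| * Real.log p / p) / 2 := by ring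
  rw [this]
  linarith

/-- **The CORE bound, regime (ii) (pure Euler product)**: block system at level `⌊x⌋` with block primes `≤ Q`
(`Q ≥ 2`), `g` completely multiplicative, `|g| ≤ 1`, `0 < α ≤ 1`, real `y`.  With `E = ⋃ blk i`,
`Σ_B = ∑_{p ∈ E}(1 - Re g(p))/p` and `Λ_E = ∑_{p ∈ E} log p/p`:
`‖𝒢_a(1+α+iy)‖ ≤ e^{12} α⁻¹ exp(-Σ_B/2 + (α + |y|/2) Λ_E)`.
[cite: MatomakiRadziwillTao2015, Appendix A, proof of Proposition A.3] -/
theorem norm_LSeries_restr_core_euler_le [DecidableEq ι] {x : ℝ} (h : IsBlockSystem 𝓙 blk ⌊x⌋₊)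
    (hg : ∀ m n, g (m * n) = g m * g n) (hg1 : g 1 = 1) (hgb : ∀ n, ‖g n‖ ≤ 1)
    {α : ℝ} (hα : 0 < α) (hα1 : α ≤ 1) (y : ℝ) :
    ‖LSeries (restr 𝓙 blk g ⌊x⌋₊) (1 + α + y * I)‖ ≤
      Real.exp 12 * (1 / α) * Real.exp (-(∑ p ∈ 𝓙.biUnion blk, (1 - (g p).re) / p) / 2 +
        (α + |y| / 2) * ∑ p ∈ 𝓙.biUnion blk, Real.log p / p) := by
  set E := 𝓙.biUnion blk with hE
  set Pr := Nat.primesBelow (⌊x⌋₊ + 1) with hPr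
  have hEsub : E ⊆ Pr := h.biUnion_subset (t := 𝓙) le_rfl
  have hres : ((1 : ℂ) + α + y * I).re = 1 + α := by simp
  have hs : (1 : ℝ) ≤ ((1 : ℂ) + α + y * I).re := by rw [hres]; linarith
  have h1 := norm_LSeries_restr_le h hg hg1 hgb hs
  -- off `E`: `Re(g p^{-s}) ≤ p^{-1-α}`
  have hoff : ∑ p ∈ Pr \ E, (g p * (p : ℂ) ^ (-((1 : ℂ) + α + y * I))).re ≤ ∑ p ∈ Pr \ E, (p : ℝ) ^ (-(1 + α)) := by
    refine Finset.sum_le_sum fun p hp => ?_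
    rw [Finset.mem_sdiff, hPr, Nat.mem_primesBelow] at hp
    have := re_mul_cpow_le hgb hp.1.2.pos ((1 : ℂ) + α + y * I)
    rwa [hres] at this
  -- `∑_{Pr \ E} p^{-1-α} = ∑_{Pr} p^{-1-α} - ∑_E p^{-1-α}`, and `1/p - p^{-1-α} ≤ α log p / p`
  have hsplit : ∑ p ∈ Pr \ E, (p : ℝ) ^ (-(1 + α)) = ∑ p ∈ Pr, (p : ℝ) ^ (-(1 + α)) - ∑ p ∈ E, (p : ℝ) ^ (-(1 + α)) := by
    rw [← Finset.sum_sdiff hEsub]; ring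
  have hdampE : ∑ p ∈ E, (1 : ℝ) / p - ∑ p ∈ E, (p : ℝ) ^ (-(1 + α)) ≤ α * ∑ p ∈ E, Real.log p / p := by
    rw [← Finset.sum_sub_distrib, Finset.mul_sum]
    refine Finset.sum_le_sum fun p hp => ?_
    have hpp : p.Prime := by
      rw [hE, Finset.mem_biUnion] at hp
      obtain ⟨i, hi, hpi⟩ := hp
      exact h.prime_of_mem hi hpi
    have hp0 : (0 : ℝ) < p := by exact_mod_cast hpp.pos
    -- `1 - p^{-α} ≤ α log p`
    have hkey : 1 - (p : ℝ) ^ (-α) ≤ α * Real.log p := by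
      have h2 : 1 + (-α * Real.log p) ≤ Real.exp (-α * Real.log p) := Real.add_one_le_exp _  |>.trans_eq' (by ring)
      rw [Real.rpow_def_of_pos hp0, show Real.log p * -α = -α * Real.log p by ring]
      linarith
    have hdec : (p : ℝ) ^ (-(1 + α)) = (p : ℝ) ^ (-α) * (1 / p) := by
      rw [show -(1 + α) = -α + (-1) by ring, Real.rpow_add hp0, Real.rpow_neg_one, one_div]
    rw [hdec]
    have : (1 : ℝ) / p - (p : ℝ) ^ (-α) * (1 / p) = (1 - (p : ℝ) ^ (-α)) * (1 / p) := by ring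
    rw [this, show α * (Real.log p / p) = α * Real.log p * (1 / p) by ring]
    exact mul_le_mul_of_nonneg_right hkey (by positivity)
  have hS := sum_primesLE_rpow_le hα hα1 ⌊x⌋₊
  have hblk := block_exponent_frozen_le h hgb hα.le y
  -- `∑_E (1 + Re g)/(2p) = K_E - Σ_B/2`
  have hKE : (∑ p ∈ E, (1 + (g p).re) / p) / 2 = ∑ p ∈ E, (1 : ℝ) / p - (∑ p ∈ E, (1 - (g p).re) / p) / 2 := by
    rw [Finset.sum_div, Finset.sum_div, ← Finset.sum_sub_distrib]
    refine Finset.sum_congr rfl fun p _ => ?_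
    ring
  have hexp : 3 + ∑ p ∈ Pr \ E, (g p * (p : ℂ) ^ (-((1 : ℂ) + α + y * I))).re +
      ∑ i ∈ 𝓙, (∑ p ∈ blk i, (p : ℝ) ^ (-((1 : ℂ) + α + y * I).re) +
        (∑ p ∈ blk i, g p * (p : ℂ) ^ (-((1 : ℂ) + α + y * I))).re) / 2 ≤
      12 + Real.log (1 / α) + (-(∑ p ∈ E, (1 - (g p).re) / p) / 2 + (α + |y| / 2) * ∑ p ∈ E, Real.log p / p) := by
    have hPrLE : ∑ p ∈ Pr, (p : ℝ) ^ (-(1 + α)) = ∑ p ∈ Nat.primesLE ⌊x⌋₊, (p : ℝ) ^ (-(1 + α)) := rfl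
    nlinarith [hoff, hsplit, hdampE, hS, hblk, hKE, hPrLE, abs_nonneg y,
      Finset.sum_nonneg (fun p (_ : p ∈ E) => show (0 : ℝ) ≤ Real.log p / p from by positivity)]
  refine h1.trans ?_
  calc Real.exp (3 + ∑ p ∈ Pr \ E, (g p * (p : ℂ) ^ (-((1 : ℂ) + α + y * I))).re +
        ∑ i ∈ 𝓙, (∑ p ∈ blk i, (p : ℝ) ^ (-((1 : ℂ) + α + y * I).re) +
          (∑ p ∈ blk i, g p * (p : ℂ) ^ (-((1 : ℂ) + α + y * I))).re) / 2)
      ≤ Real.exp (12 + Real.log (1 / α) + (-(∑ p ∈ E, (1 - (g p).re) / p) / 2 + (α + |y| / 2) * ∑ p ∈ E, Real.log p / p)) :=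
        Real.exp_le_exp.2 hexp
    _ = _ := by rw [Real.exp_add, Real.exp_add, Real.exp_log (by positivity)]

/-- **The CORE bound, regime (i) (Poisson transport for the block-free part)**: block system at level `⌊x⌋`
(`x ≥ 3`), `g` completely multiplicative, `|g| ≤ 1`, `0 < α`, `T₀ > 0`, `|y| ≤ T₀`.  With `E = ⋃ blk i`,
`g_E = g 1_{(n,E)=1}` (completely multiplicative, `= 0` on `E`), `M_E = min_{|t| ≤ 2T₀} 𝔻(g_E, n^{it}; x)²`:
`‖𝒢_a(1+α+iy)‖ ≤ (e⁵ log x · e^{-M_E} + (2α/T₀) e⁵ log x) · exp((∑_E (1 + Re g(p))/p)/2 + (|y|/2) Λ_E + 2)`,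
from `𝒢_a = G_∁ ∏_i (G_i - 1)` with `G_∁` the Euler product of `g_E` (`Halasz.norm_G_shift_le`) and the frozen block
exponent. [cite: MatomakiRadziwillTao2015, Appendix A, proof of Proposition A.3] -/
theorem norm_LSeries_restr_core_poisson_le [DecidableEq ι] {x : ℝ} (h : IsBlockSystem 𝓙 blk ⌊x⌋₊)
    (hg : ∀ m n, g (m * n) = g m * g n) (hg1 : g 1 = 1) (hgb : ∀ n, ‖g n‖ ≤ 1) (hx : 3 ≤ x)
    {α T₀ y : ℝ} (hα : 0 < α) (hT₀ : 0 < T₀) (hy : |y| ≤ T₀) :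
    ‖LSeries (restr 𝓙 blk g ⌊x⌋₊) (1 + α + y * I)‖ ≤
      (Real.exp 5 * Real.log x * Real.exp (-Sieve.minPretentiousDistSq (sieveOut (𝓙.biUnion blk) g) x (2 * T₀)) +
          2 * α / T₀ * (Real.exp 5 * Real.log x)) *
        Real.exp ((∑ p ∈ 𝓙.biUnion blk, (1 + (g p).re) / p) / 2 +
          |y| / 2 * ∑ p ∈ 𝓙.biUnion blk, Real.log p / p + 2) := by
  set E := 𝓙.biUnion blk with hE
  have hEp : ∀ p ∈ E, p.Prime := fun p hp => by
    rw [hE, Finset.mem_biUnion] at hp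
    obtain ⟨i, hi, hpi⟩ := hp
    exact h.prime_of_mem hi hpi
  have hres : ((1 : ℂ) + α + y * I).re = 1 + α := by simp
  have hs0 : (0 : ℝ) < ((1 : ℂ) + α + y * I).re := by rw [hres]; linarith
  have hs1 : (1 : ℝ) ≤ ((1 : ℂ) + α + y * I).re := by rw [hres]; linarith
  rw [(LSeries_restr_eq h hg hg1 hgb hs0).2, norm_mul]
  -- the block-free Euler product is the series of `g_E`
  have hGE := (LSeries_sieveOut_eq (N := ⌊x⌋₊) hg hg1 hgb hEp hs0).2
  rw [← hE, ← hGE]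
  have hmulE := sieveOut_mul hEp hg
  have h1E := sieveOut_one (g := g) hEp hg1
  have hbE := norm_sieveOut_le hgb E
  have hG := norm_G_shift_le hmulE h1E hbE hx hα hT₀ hy
  have hprod := norm_prod_blockEuler_sub_one_le h hgb hs1
  have hblk := block_exponent_frozen_le h hgb hα.le y
  have hlog : 0 < Real.log x := Real.log_pos (by linarith)
  refine mul_le_mul hG (hprod.trans (Real.exp_le_exp.2 ?_)) (norm_nonneg _) (by positivity)
  rw [← hE] at hblk
  linarith

end Restricted

end Halasz

end Literature.NumberTheory.LFunctions
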